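import Literature.AnabelianGeometry.EtaleTheta.SettingModelTateDoubleUnderline
import Literature.AnabelianGeometry.EtaleTheta.SettingModelTateThetaCusp
import Literature.AnabelianGeometry.EtaleTheta.SettingModelTateInversion
import Literature.AnabelianGeometry.EtaleTheta.SettingModel2InversionCoverings
import Literature.AnabelianGeometry.EtaleTheta.SettingModelChiTwistedSections
import HarnessLib

/-!
# The STAGE-2 model: the cocycle-corrected inversion preserves `Π^tp_X̲̲`, and the cusp-section clause — census clauses
# of [EtTh] Def. 2.5 (i)(b) at the stage-2 constructor site (proof-only)

Mochizuki, *The étale theta function …*, Publ. RIMS **45** (2009) [EtTh], Def. 2.5 (i) p. 39 ("determined … by the choice of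
a splitting of `D_x → G_K` … compatible with the `{±1}`-structure") [cite: MochizukiEtTh2009, Def 2.5 (i) p.39].  abc-iut
cell, layer L2, prover abc-iut-L2-d1 (gen 5); PROOF-ONLY stage-2 twin of this seat's `SettingModelChiInversionTheta` /
`SettingModelChiDoubleUnderlineCensus` (13:00Z v-next census item C10 at the SECOND constructor site of `DoubleUnderline`),
over this seat's `Huuχq` (`SettingModelTateDoubleUnderline`), abc-iut-w5-d249's cocycle-corrected stage-2 inversion
`inversionχq p i j` (`SettingModelTateInversion`: `(γ, σ) ↦ (ι_Γ γ · (b^{κ_p(σ)^{j−2i}}, 0), σ)` — over `G_K` but NOT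
section-fixing), its cusped record `modelχq′` (`SettingModelTateThetaCusp`) and abc-iut-L2-t1's `levelHom_gfpInv = negXY`.

* **`inversionχq_mem_Huuχq_iff`** / **`map_Huuχq_inversionχq`** — `ι(Π^tp_X̲̲) = Π^tp_X̲̲` at stage 2: the correction
  `b^{d(σ)}` lies on the `b`-axis, whose level `(0, t, 0)` is in `{x = 0, z = 0}`, and `ι_Γ` acts by `negXY` on levels;
* `not_normal_Huuχq` — as at stage 1, `Π^tp_X̲̲` is NOT normal in `Π^tp_X` (`l > 1`);
* **`map_aug_decomp_inf_Huuχq_modelχq'`** — at the cusped stage-2 model the cusp's decomposition group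
  `b^Ẑ ⋊ G_{ℚ_p}` meets `Π^tp_X̲̲` in a subgroup mapping ONTO `G_K` (the section `inr`).
So the recommended census pair {ι-stability w.r.t. the inversion datum, cusp-section clause} holds at EVERY χ-model
constructor site of `DoubleUnderline` (stage 1: p440780/p441295; stage 2: here), while the ∀-over-`Π^tp_C` wording fails at
both.  SEMI-SYNTHETIC MODEL, consistency evidence only; nothing of [EtTh] asserted; no side taken on [IUTchIII] Cor. 3.12.
-/

noncomputable section

namespace Literature.AnabelianGeometry.EtaleTheta.SettingModel

open Literature.AnabelianGeometry.SemiGraphs _root_.Function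

variable (p : ℕ) [Fact p.Prime] (i j : ℤ) (l : ℕ+) (hl : Odd (l : ℕ))

/-- `negXY (x, y, z) = (−x, −y, z)`. [cite: MochizukiEtTh2009, Prop 2.2 (i) p.37] -/
private theorem negXY_apply_aux' {R : Type*} [CommRing R] (a : Heis R) : Heis.negXY a = ⟨-a.x, -a.y, a.z⟩ := rfl

/-- `b^t ∈ dUU l`: the `b`-axis has levels `(0, t mod l, 0)`. [cite: MochizukiEtTh2009, Def 2.5 (i) p.39] -/
theorem bPowGfp_mem_dUU (t : ZH) : bPowGfp t ∈ dUU l := by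
  rw [mem_dUU_iff, levelHom_bPowGfp]
  exact ⟨rfl, rfl⟩

/-- `ι_Γ γ ∈ dUU l ↔ γ ∈ dUU l` (levels `negXY`). [cite: MochizukiEtTh2009, Def 2.5 (i) p.39] -/
theorem gfpInv_mem_dUU_iff (γ : Gfp) : gfpInv γ ∈ dUU l ↔ γ ∈ dUU l := by
  rw [mem_dUU_iff, mem_dUU_iff, levelHom_gfpInv, negXY_apply_aux']
  exact and_congr neg_eq_zero Iff.rfl

/-- **`ι(g) ∈ Π^tp_X̲̲ ↔ g ∈ Π^tp_X̲̲`** for the cocycle-corrected stage-2 inversion (`(ι g).left = ι_Γ g.left · b^{d}`).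
[cite: MochizukiEtTh2009, Def 2.5 (i) p.39] -/
theorem inversionχq_mem_Huuχq_iff (g : PiTpχq p i j) :
    inversionχq p i j g ∈ Huuχq p i j l hl ↔ g ∈ Huuχq p i j l hl := by
  change (inversionχq p i j g).left ∈ dUU l ∧ (inversionχq p i j g).right ∈ (⊤ : Subgroup (GQp p)) ↔
    g.left ∈ dUU l ∧ g.right ∈ (⊤ : Subgroup (GQp p))
  rw [and_iff_left (Subgroup.mem_top _), and_iff_left (Subgroup.mem_top _), inversionχq_apply, tateInversion_left]
  constructor
  · intro h
    have h' := (dUU l).mul_mem h ((dUU l).inv_mem (bPowGfp_mem_dUU l (invDefect (tatePairHom p i j g.right))))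
    rw [mul_inv_cancel_right] at h'
    exact (gfpInv_mem_dUU_iff l _).mp h'
  · intro h
    exact (dUU l).mul_mem ((gfpInv_mem_dUU_iff l _).mpr h) (bPowGfp_mem_dUU l _)

/-- **`ι(Π^tp_X̲̲) = Π^tp_X̲̲` at the stage-2 model** (census C10, ι-stability, second constructor site).
[cite: MochizukiEtTh2009, Def 2.5 (i) p.39] -/
theorem map_Huuχq_inversionχq :
    (Huuχq p i j l hl).map (inversionχq p i j).toMulEquiv.toMonoidHom = Huuχq p i j l hl := by
  ext g
  constructor
  · rintro ⟨h, hh, rfl⟩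
    exact (inversionχq_mem_Huuχq_iff p i j l hl h).mpr hh
  · intro hg
    refine ⟨inversionχq p i j g, (inversionχq_mem_Huuχq_iff p i j l hl g).mpr hg, ?_⟩
    exact inversionχq_inversionχq p i j g

/-! ### `Π^tp_X̲̲` is not normal in `Π^tp_X` at stage 2 either -/

/-- `inl (η b, 0) ∈ Π^tp_X̲̲` (stage 2). [cite: MochizukiEtTh2009, Def 2.5 (i) p.39] -/
theorem inl_gfpOf_of_one_mem_Huuχq :
    (SemidirectProduct.inl (gfpOf (FreeGroup.of 1)) : PiTpχq p i j) ∈ Huuχq p i j l hl := by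
  rw [inl_mem_Huuχq_iff, mem_dUU_iff, levelHom_gfpOf, heisHom_of_one, Heis.map_apply]
  exact ⟨by simp, by simp⟩

/-- **`Π^tp_X̲̲` is NOT normal in `Π^tp_X`** at the stage-2 model (`l > 1`; same witness as at stage 1: conjugating `inl b` by
`inl a` gives level `(0, 1, 1)`). [cite: MochizukiEtTh2009, Def 2.5 (i) p.39] -/
theorem not_normal_Huuχq (hl1 : 1 < (l : ℕ)) : ¬ (Huuχq p i j l hl).Normal := by
  intro hN
  have hconj := hN.conj_mem _ (inl_gfpOf_of_one_mem_Huuχq p i j l hl) (SemidirectProduct.inl (gfpOf (FreeGroup.of 0)))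
  rw [← map_inv, ← map_mul, ← map_mul, inl_mem_Huuχq_iff, mem_dUU_iff] at hconj
  have hz := hconj.2
  rw [map_mul, map_mul, map_inv, levelHom_gfpOf, levelHom_gfpOf, heisHom_of_zero, heisHom_of_one] at hz
  simp at hz
  haveI : Fact (1 < (l : ℕ)) := ⟨hl1⟩
  exact one_ne_zero hz

/-! ### The cusp-section clause at the cusped stage-2 model -/

/-- `inr σ ∈ D_x = b^Ẑ ⋊ G_{ℚ_p}` (stage 2). [cite: MochizukiEtTh2009, Def 2.5 (i) p.39] -/
theorem inr_mem_cuspDecompχq (σ : GQp p) : (SemidirectProduct.inr σ : PiTpχq p i j) ∈ cuspDecompχq p i j := by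
  rw [mem_cuspDecompχq_iff, SemidirectProduct.left_inr]
  exact Subgroup.one_mem _

variable (hj : Even j)

/-- **Def. 2.5 (i)(b) at the cusped stage-2 model**: the cusp's decomposition group meets `Π^tp_X̲̲` in a subgroup mapping
onto `G_K` (the Galois section `inr` lies in both). [cite: MochizukiEtTh2009, Def 2.5 (i) p.39] -/
theorem map_aug_decomp_inf_Huuχq_modelχq' (x : (ThetaSetting.modelχq' p i j hj).Pt) :
    ((ThetaSetting.modelχq' p i j hj).decomp x ⊓ Huuχq p i j l hl).map (ThetaSetting.modelχq' p i j hj).aug.toMonoidHom =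
      (ThetaSetting.modelχq' p i j hj).GK := by
  have hGK : (ThetaSetting.modelχq' p i j hj).GK = ⊤ := IntermediateField.fixingSubgroup_bot
  rw [hGK]
  refine eq_top_iff.mpr fun σ _ => ?_
  exact ⟨SemidirectProduct.inr σ, Subgroup.mem_inf.mpr ⟨inr_mem_cuspDecompχq p i j σ, inr_mem_Huuχq p i j l hl σ⟩, rfl⟩

/-- **C10 at the stage-2 constructor site, summarised**: `Π^tp_X̲̲` is stable under the cocycle-corrected inversion, meets the
cusp's decomposition group over all of `G_K`, and is not normal in `Π^tp_X` (`l > 1`). [cite: MochizukiEtTh2009, Def 2.5 (i) p.39] -/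
theorem doubleUnderline_census_modelχq (hl1 : 1 < (l : ℕ)) :
    (Huuχq p i j l hl).map (inversionχq p i j).toMulEquiv.toMonoidHom = Huuχq p i j l hl ∧
      (∀ x : (ThetaSetting.modelχq' p i j hj).Pt,
        ((ThetaSetting.modelχq' p i j hj).decomp x ⊓ Huuχq p i j l hl).map (ThetaSetting.modelχq' p i j hj).aug.toMonoidHom =
          (ThetaSetting.modelχq' p i j hj).GK) ∧
      ¬ (Huuχq p i j l hl).Normal :=
  ⟨map_Huuχq_inversionχq p i j l hl, map_aug_decomp_inf_Huuχq_modelχq' p i j l hl hj, not_normal_Huuχq p i j l hl hl1⟩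

end Literature.AnabelianGeometry.EtaleTheta.SettingModel

end
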